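import Summits.HubbardSuperconductivity.HubbardSuperconductivity.Theorems.PerWidthThermodynamics.Negative.LadderFold

/-!
# Fermi sets of the free two-leg ladder: exchange, conjugate pairing, parity, the unpaired level

Second file of the `U = 0` stiffness twin for crux stmt-HubbardSuperconductivity-18510 (see `LadderFold`).
A Fermi set `F` of the untwisted ladder band (`ε ≤ μ` on `F`, `μ ≤ ε` off `F`, as produced by
`Literature…exists_fermiSet`) is analysed through the conjugation `(a,b) ↦ (-a,b)`, sorry-free:

* exchange lemmas `mem_of_fold_lt`, `fold_le_of_mem_of_not_mem`; `eq_of_unpaired` (at most one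
  occupied level with empty mirror per band); `half_not_mem` (`(L/2,b) ∉ F` once `#F < L`),
  `zero_zero_mem`, `zero_one_mem` (both band bottoms occupied once `#F ≥ L/2 + 2`);
* `filter_conj_eq_self_eq` — the self-conjugate occupied levels are exactly `(0,0), (0,1)`;
  `even_card_filter_paired` — the conjugate-paired ones are even in number (involution counted in `ℤ/2`);
* **`existsUnique_unpaired`** — for `#F` ODD (`L` even, `L/2 + 2 ≤ #F < L`) there is exactly one occupied
  `k⋆ = (a⋆,b⋆)` with `(-a⋆,b⋆)` empty: the open-shell electron of the free ladder;
* **`sum_sin_eq_sin_unpaired`** — the sine (current) sum of `F` is `sin(2πa⋆/L)`: paired levels cancel.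

This is the free-fermion mechanism behind the parity-class paramagnetism of thin Hubbard tubes
(`Cruxes/PerWidthThermodynamics`: leads c0–c2, idea `dilute-pair-anchor` §rung 1) made exact at `M = 2`.
Folklore. No definitions, no named facts. REUSED: `neg_eq_self_iff_of_even`, `val_half` (FreeOpenShell),
the fold API of `LadderFold`.
-/

noncomputable section

namespace Summit.HubbardSuperconductivity.HubbardSuperconductivity.Theorems.PerWidthThermodynamics.Negative

set_option linter.dupNamespace false -- summit = problem name (single-conjunct summit), D-0017

open scoped BigOperators Classical
open Finset Summit.HubbardSuperconductivity.HubbardSuperconductivity.Theorems.WidthHaldane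
open Summit.HubbardSuperconductivity.HubbardSuperconductivity.Theorems.WidthUniformThermodynamics.Negative

/-! ### Fermi sets of the free ladder: exchange, pairing, parity -/

section FermiSea

variable {L : ℕ} [NeZero L] {F : Finset (ZMod L × ZMod 2)} {μ : ℝ}

/-- **Exchange (strict)**: a level strictly below an occupied level of the same band is occupied. [folklore] -/
theorem mem_of_fold_lt (hF : ∀ k ∈ F, ladderTwistedBand L 0 k ≤ μ)
    (hF' : ∀ k ∉ F, μ ≤ ladderTwistedBand L 0 k) {k k' : ZMod L × ZMod 2} (hk' : k' ∈ F)
    (h2 : k.2 = k'.2) (hlt : min k.1.val (L - k.1.val) < min k'.1.val (L - k'.1.val)) : k ∈ F := by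
  by_contra hk
  have h1 := hF' k hk
  have h3 := hF k' hk'
  have h4 := (ladderBand_zero_lt_iff h2).2 hlt
  linarith

/-- **Exchange (weak)**: an occupied level is not above an empty level of the same band. [folklore] -/
theorem fold_le_of_mem_of_not_mem (hF : ∀ k ∈ F, ladderTwistedBand L 0 k ≤ μ)
    (hF' : ∀ k ∉ F, μ ≤ ladderTwistedBand L 0 k) {k k' : ZMod L × ZMod 2} (hk : k ∈ F) (hk' : k' ∉ F)
    (h2 : k.2 = k'.2) : min k.1.val (L - k.1.val) ≤ min k'.1.val (L - k'.1.val) := by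
  have h1 := hF k hk
  have h3 := hF' k' hk'
  exact (ladderBand_zero_le_iff h2).1 (by linarith)

/-- **At most one unpaired level per band.** If `k, k'` are occupied with empty mirror images
`(-a, b)` and lie in the same band, they coincide. [folklore] -/
theorem eq_of_unpaired (hF : ∀ k ∈ F, ladderTwistedBand L 0 k ≤ μ)
    (hF' : ∀ k ∉ F, μ ≤ ladderTwistedBand L 0 k) {k k' : ZMod L × ZMod 2} (hk : k ∈ F)
    (hkc : (-k.1, k.2) ∉ F) (hk' : k' ∈ F) (hkc' : (-k'.1, k'.2) ∉ F) (h2 : k.2 = k'.2) : k = k' := by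
  have h1 := fold_le_of_mem_of_not_mem hF hF' hk hkc' (k' := (-k'.1, k'.2)) h2
  have h3 := fold_le_of_mem_of_not_mem hF hF' hk' hkc (k' := (-k.1, k.2)) h2.symm
  simp only at h1 h3
  rw [fold_neg] at h1 h3
  rcases (fold_eq_fold_iff k.1 k'.1).1 (le_antisymm h1 h3) with e | e
  · exact Prod.ext e.symm h2
  · exfalso
    apply hkc
    have : ((-k.1, k.2) : ZMod L × ZMod 2) = k' := Prod.ext (show -k.1 = k'.1 by rw [e]) h2
    rw [this]; exact hk'

/-- **The top levels `(L/2, b)` are empty** as soon as `#F < L` (an occupied top level drags its whole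
band into `F`). [folklore] -/
theorem half_not_mem (hF : ∀ k ∈ F, ladderTwistedBand L 0 k ≤ μ)
    (hF' : ∀ k ∉ F, μ ≤ ladderTwistedBand L 0 k) (hLe : Even L) (hcard : F.card < L) (b : ZMod 2) :
    ((((L / 2 : ℕ) : ZMod L)), b) ∉ F := by
  intro hmem
  have hhalf : min (((L / 2 : ℕ) : ZMod L)).val (L - (((L / 2 : ℕ) : ZMod L)).val) = L / 2 :=
    (fold_eq_half_iff hLe _).2 rfl
  have hall : ∀ a : ZMod L, (a, b) ∈ F := by
    intro a
    by_cases ha : a = ((L / 2 : ℕ) : ZMod L)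
    · rw [ha]; exact hmem
    · refine mem_of_fold_lt hF hF' hmem rfl ?_
      have h2 := two_mul_fold_le a
      have hne : min a.val (L - a.val) ≠ L / 2 := fun h => ha ((fold_eq_half_iff hLe a).1 h)
      simp only
      rw [hhalf]
      omega
  have hsub : (univ : Finset (ZMod L)).image (fun a => (a, b)) ⊆ F := by
    intro k hk
    obtain ⟨a, -, rfl⟩ := mem_image.1 hk
    exact hall a
  have h := card_le_card hsub
  rw [card_image_of_injective _ (fun a a' h => (Prod.ext_iff.1 h).1), card_univ, ZMod.card] at h
  omega

/-- **The bottom of the bonding band is occupied** (`F` non-empty). [folklore] -/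
theorem zero_zero_mem (hF : ∀ k ∈ F, ladderTwistedBand L 0 k ≤ μ)
    (hF' : ∀ k ∉ F, μ ≤ ladderTwistedBand L 0 k) (hne : F.Nonempty) : ((0 : ZMod L), (0 : ZMod 2)) ∈ F := by
  by_contra h0
  obtain ⟨k, hk⟩ := hne
  rcases ((by decide : ∀ b : ZMod 2, b = 0 ∨ b = 1) k.2) with hb | hb
  · have h := fold_le_of_mem_of_not_mem hF hF' hk h0 hb
    simp only [ZMod.val_zero, Nat.sub_zero, Nat.zero_min, Nat.le_zero, fold_eq_zero_iff] at h
    apply h0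
    have : k = ((0 : ZMod L), (0 : ZMod 2)) := Prod.ext h hb
    rw [← this]; exact hk
  · have h1 := hF k hk
    have h2 := hF' _ h0
    have h3 := neg_one_le_ladderBand_zero_of_snd_eq_one hb
    rw [ladderBand_zero_zero_zero] at h2
    linarith

/-- **The bottom of the antibonding band is occupied** once `#F ≥ L/2 + 2` (otherwise `F` sits in the
lower half `cos ≥ 0` of the bonding band, which holds only `2⌊L/4⌋ + 1 ≤ L/2 + 1` levels). [folklore] -/
theorem zero_one_mem (hF : ∀ k ∈ F, ladderTwistedBand L 0 k ≤ μ)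
    (hF' : ∀ k ∉ F, μ ≤ ladderTwistedBand L 0 k) (hbig : L / 2 + 2 ≤ F.card) :
    ((0 : ZMod L), (1 : ZMod 2)) ∈ F := by
  by_contra h01
  have hL : (0 : ℝ) < L := by exact_mod_cast Nat.pos_of_ne_zero (NeZero.ne L)
  have hsub : F ⊆ (univ.filter fun a : ZMod L => min a.val (L - a.val) ≤ L / 4).image
      (fun a => (a, (0 : ZMod 2))) := by
    intro k hk
    have hk2 : k.2 = 0 := by
      rcases ((by decide : ∀ b : ZMod 2, b = 0 ∨ b = 1) k.2) with hb | hb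
      · exact hb
      · exfalso
        have h := fold_le_of_mem_of_not_mem hF hF' hk h01 hb
        simp only [ZMod.val_zero, Nat.sub_zero, Nat.zero_min, Nat.le_zero, fold_eq_zero_iff] at h
        apply h01
        have : k = ((0 : ZMod L), (1 : ZMod 2)) := Prod.ext h hb
        rw [← this]; exact hk
    rw [mem_image]
    refine ⟨k.1, mem_filter.2 ⟨mem_univ _, ?_⟩, Prod.ext rfl hk2.symm⟩
    -- `ε k ≤ μ ≤ ε(0,1) = -1` forces `cos(2π|a|/L) ≥ 0`, i.e. `|a| ≤ L/4`
    have h1 := hF k hk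
    have h2 := hF' _ h01
    rw [ladderBand_zero_zero_one] at h2
    rw [ladderBand_zero_eq, hk2, ZMod.val_zero, pow_zero] at h1
    have hcos : 0 ≤ Real.cos (2 * Real.pi * ((min k.1.val (L - k.1.val) : ℕ) : ℝ) / L) := by linarith
    obtain ⟨h0, hπ⟩ := fold_angle_mem k.1
    have hle : 2 * Real.pi * ((min k.1.val (L - k.1.val) : ℕ) : ℝ) / L ≤ Real.pi / 2 := by
      by_contra hlt
      push Not at hlt
      have := Real.cos_neg_of_pi_div_two_lt_of_lt hlt (by linarith)
      linarith
    rw [div_le_iff₀ hL] at hle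
    have h4 : 4 * ((min k.1.val (L - k.1.val) : ℕ) : ℝ) ≤ L := by nlinarith [Real.pi_pos]
    have h4' : 4 * min k.1.val (L - k.1.val) ≤ L := by exact_mod_cast h4
    omega
  have hL0 : 0 < L := Nat.pos_of_ne_zero (NeZero.ne L)
  have h := card_le_card hsub
  rw [card_image_of_injective _ (fun a a' h => (Prod.ext_iff.1 h).1),
    card_filter_fold_le (L / 4) (by omega)] at h
  omega

/-- **The self-conjugate occupied levels are exactly the two band bottoms** (`L` even,
`L/2 + 2 ≤ #F < L`). [folklore] -/
theorem filter_conj_eq_self_eq (hF : ∀ k ∈ F, ladderTwistedBand L 0 k ≤ μ)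
    (hF' : ∀ k ∉ F, μ ≤ ladderTwistedBand L 0 k) (hLe : Even L) (hbig : L / 2 + 2 ≤ F.card)
    (hsmall : F.card < L) :
    (F.filter fun k => ((-k.1, k.2) : ZMod L × ZMod 2) = k) = {((0 : ZMod L), (0 : ZMod 2)), (0, 1)} := by
  ext k
  simp only [mem_filter, mem_insert, mem_singleton]
  constructor
  · rintro ⟨hk, hfix⟩
    have h1 : -k.1 = k.1 := congrArg Prod.fst hfix
    rcases (neg_eq_self_iff_of_even hLe k.1).1 h1 with h0 | hh
    · rcases ((by decide : ∀ b : ZMod 2, b = 0 ∨ b = 1) k.2) with hb | hb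
      · left; exact Prod.ext h0 hb
      · right; exact Prod.ext h0 hb
    · exfalso
      apply half_not_mem hF hF' hLe hsmall k.2
      have : k = ((((L / 2 : ℕ) : ZMod L)), k.2) := Prod.ext hh rfl
      rw [← this]; exact hk
  · have hne : F.Nonempty := card_pos.1 (by omega)
    rintro (rfl | rfl)
    · exact ⟨zero_zero_mem hF hF' hne, by simp⟩
    · exact ⟨zero_one_mem hF hF' hbig, by simp⟩

omit [NeZero L] in
/-- **The conjugate-paired occupied levels are even in number** (the fixed-point-free involution
`(a,b) ↦ (-a,b)` on them, counted in `ℤ/2`). [folklore] -/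
theorem even_card_filter_paired (F : Finset (ZMod L × ZMod 2)) :
    Even ((F.filter fun k => ((-k.1, k.2) : ZMod L × ZMod 2) ∈ F ∧ ((-k.1, k.2) : ZMod L × ZMod 2) ≠ k)).card := by
  set P := F.filter fun k => ((-k.1, k.2) : ZMod L × ZMod 2) ∈ F ∧ ((-k.1, k.2) : ZMod L × ZMod 2) ≠ k
    with hP
  have h_mem : ∀ a ∈ P, ((-a.1, a.2) : ZMod L × ZMod 2) ∈ P := by
    intro a ha
    rw [hP, mem_filter] at ha ⊢
    obtain ⟨haF, hc, hne⟩ := ha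
    refine ⟨hc, ?_, ?_⟩
    · simpa using haF
    · simp only [neg_neg, Prod.mk.eta, ne_eq]
      intro h; exact hne (by rw [← h])
  have h := Finset.sum_involution (s := P) (f := fun _ ↦ (1 : ZMod 2)) (fun a _ ↦ ((-a.1, a.2) : ZMod L × ZMod 2))
    (fun a _ ↦ by decide) (fun a ha _ ↦ ((mem_filter.1 ha).2).2) (fun a ha ↦ h_mem a ha)
    (fun a _ ↦ by simp)
  rw [Finset.sum_const, nsmul_eq_mul, mul_one] at h
  exact ZMod.natCast_eq_zero_iff_even.mp h

/-- **Odd filling ⇒ exactly one unpaired level.** For a Fermi set `F` of the free ladder with `L` even,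
`#F` odd and `L/2 + 2 ≤ #F < L`, there is a unique occupied `k⋆ = (a⋆, b⋆)` whose mirror `(-a⋆, b⋆)`
is empty (parity count: `#F = #unpaired + #paired + #fixed` with `#paired` even and `#fixed = 2`;
uniqueness by `eq_of_unpaired` in each band). [folklore] -/
theorem existsUnique_unpaired (hF : ∀ k ∈ F, ladderTwistedBand L 0 k ≤ μ)
    (hF' : ∀ k ∉ F, μ ≤ ladderTwistedBand L 0 k) (hLe : Even L) (hodd : Odd F.card)
    (hbig : L / 2 + 2 ≤ F.card) (hsmall : F.card < L) :
    ∃ ks ∈ F, ((-ks.1, ks.2) : ZMod L × ZMod 2) ∉ F ∧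
      ∀ k ∈ F, ((-k.1, k.2) : ZMod L × ZMod 2) ∉ F → k = ks := by
  -- parity count: `#F = #D + #E`, `#E = #P + #Fix`, `#P` even, `#Fix = 2`
  have hsplit₁ := Finset.card_filter_add_card_filter_not (s := F)
    (fun k => ((-k.1, k.2) : ZMod L × ZMod 2) ∉ F)
  have hsplit₂ := Finset.card_filter_add_card_filter_not
    (s := F.filter fun k => ¬ ((-k.1, k.2) : ZMod L × ZMod 2) ∉ F)
    (fun k => ((-k.1, k.2) : ZMod L × ZMod 2) ≠ k)
  have hP : ((F.filter fun k => ¬ ((-k.1, k.2) : ZMod L × ZMod 2) ∉ F).filter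
      fun k => ((-k.1, k.2) : ZMod L × ZMod 2) ≠ k) =
      F.filter fun k => ((-k.1, k.2) : ZMod L × ZMod 2) ∈ F ∧ ((-k.1, k.2) : ZMod L × ZMod 2) ≠ k := by
    rw [Finset.filter_filter]
    congr 1; ext k; push Not; rfl
  have hFix : ((F.filter fun k => ¬ ((-k.1, k.2) : ZMod L × ZMod 2) ∉ F).filter
      fun k => ¬ ((-k.1, k.2) : ZMod L × ZMod 2) ≠ k) =
      F.filter fun k => ((-k.1, k.2) : ZMod L × ZMod 2) = k := by
    ext k
    simp only [mem_filter, not_not]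
    constructor
    · rintro ⟨⟨hk, -⟩, h⟩; exact ⟨hk, h⟩
    · rintro ⟨hk, h⟩; exact ⟨⟨hk, by rw [h]; exact hk⟩, h⟩
  have hFixcard : (F.filter fun k => ((-k.1, k.2) : ZMod L × ZMod 2) = k).card = 2 := by
    rw [filter_conj_eq_self_eq hF hF' hLe hbig hsmall, card_insert_of_notMem, card_singleton]
    simp
  have hPeven := even_card_filter_paired F
  rw [← hP] at hPeven
  rw [hFix, hFixcard] at hsplit₂
  -- `#D` is odd
  have hDodd : Odd (F.filter fun k => ((-k.1, k.2) : ZMod L × ZMod 2) ∉ F).card := by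
    rw [← hsplit₁, ← hsplit₂] at hodd
    rcases hPeven with ⟨p, hp⟩
    rcases hodd with ⟨q, hq⟩
    rw [hp] at hq
    refine ⟨q - p - 1, ?_⟩
    omega
  -- hence non-empty
  obtain ⟨ks, hks⟩ : (F.filter fun k => ((-k.1, k.2) : ZMod L × ZMod 2) ∉ F).Nonempty :=
    card_pos.1 hDodd.pos
  rw [mem_filter] at hks
  refine ⟨ks, hks.1, hks.2, ?_⟩
  intro k hk hkc
  by_cases h2 : k.2 = ks.2
  · exact eq_of_unpaired hF hF' hk hkc hks.1 hks.2 h2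
  · -- two unpaired levels in different bands would make `#D = 2`
    exfalso
    have hDeq : (F.filter fun k => ((-k.1, k.2) : ZMod L × ZMod 2) ∉ F) = {k, ks} := by
      ext k''
      rw [mem_filter, mem_insert, mem_singleton]
      constructor
      · rintro ⟨hk'', hkc''⟩
        have hb : k''.2 = k.2 ∨ k''.2 = ks.2 := by
          rcases ((by decide : ∀ b : ZMod 2, b = 0 ∨ b = 1) k''.2) with h | h <;>
            rcases ((by decide : ∀ b : ZMod 2, b = 0 ∨ b = 1) k.2) with h' | h' <;>
              rcases ((by decide : ∀ b : ZMod 2, b = 0 ∨ b = 1) ks.2) with h'' | h''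
          all_goals first
            | exact Or.inl (h.trans h'.symm)
            | exact Or.inr (h.trans h''.symm)
            | exact absurd (h'.trans h''.symm) h2
        rcases hb with hb | hb
        · exact Or.inl (eq_of_unpaired hF hF' hk'' hkc'' hk hkc hb)
        · exact Or.inr (eq_of_unpaired hF hF' hk'' hkc'' hks.1 hks.2 hb)
      · rintro (rfl | rfl)
        · exact ⟨hk, hkc⟩
        · exact ⟨hks.1, hks.2⟩
    have hne : k ≠ ks := fun h => h2 (by rw [h])
    rw [hDeq, card_insert_of_notMem (by simpa using hne), card_singleton] at hDodd
    exact absurd hDodd (by decide)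

/-- **The sine sum of a Fermi set is the sine of its unpaired level**: the conjugate-paired levels
cancel in pairs (`sin(2π(-a)/L) = -sin(2πa/L)`; the self-conjugate ones have `sin = 0`). [folklore] -/
theorem sum_sin_eq_sin_unpaired (hLe : Even L) {ks : ZMod L × ZMod 2} (hks : ks ∈ F)
    (hksc : ((-ks.1, ks.2) : ZMod L × ZMod 2) ∉ F)
    (huniq : ∀ k ∈ F, ((-k.1, k.2) : ZMod L × ZMod 2) ∉ F → k = ks) :
    ∑ k ∈ F, Real.sin (2 * Real.pi * (k.1.val : ℝ) / L) = Real.sin (2 * Real.pi * (ks.1.val : ℝ) / L) := by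
  rw [← Finset.sum_filter_add_sum_filter_not F (fun k => ((-k.1, k.2) : ZMod L × ZMod 2) ∈ F)]
  have hpaired : ∑ k ∈ F.filter (fun k => ((-k.1, k.2) : ZMod L × ZMod 2) ∈ F),
      Real.sin (2 * Real.pi * (k.1.val : ℝ) / L) = 0 := by
    refine Finset.sum_involution (fun a _ ↦ ((-a.1, a.2) : ZMod L × ZMod 2)) ?_ ?_ ?_ ?_
    · intro a _
      simp only
      rw [sin_two_pi_mul_val_neg]; ring
    · intro a _ hne heq
      apply hne
      have h1 : -a.1 = a.1 := congrArg Prod.fst heq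
      rcases (neg_eq_self_iff_of_even hLe a.1).1 h1 with h0 | hh
      · simp only [h0, ZMod.val_zero, Nat.cast_zero, mul_zero, zero_div, Real.sin_zero]
      · simp only [hh, val_half]
        obtain ⟨l, hl⟩ := hLe
        have hL2 : ((L / 2 : ℕ) : ℝ) * 2 = L := by
          have : L / 2 = l := by omega
          rw [this, hl]; push_cast; ring
        have hL0 : (L : ℝ) ≠ 0 := Nat.cast_ne_zero.2 (NeZero.ne L)
        have : 2 * Real.pi * ((L / 2 : ℕ) : ℝ) / L = Real.pi := by
          field_simp
          linarith [hL2]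
        rw [this, Real.sin_pi]
    · intro a ha
      rw [mem_filter] at ha ⊢
      refine ⟨ha.2, ?_⟩
      simpa using ha.1
    · intro a _
      simp
  have hD : (F.filter fun k => ¬ ((-k.1, k.2) : ZMod L × ZMod 2) ∈ F) = {ks} := by
    ext k
    rw [mem_filter, mem_singleton]
    constructor
    · rintro ⟨hk, hkc⟩; exact huniq k hk hkc
    · rintro rfl; exact ⟨hks, hksc⟩
  rw [hpaired, hD, sum_singleton, zero_add]

end FermiSea

end Summit.HubbardSuperconductivity.HubbardSuperconductivity.Theorems.PerWidthThermodynamics.Negative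

end
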